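/-
Copyright (c) 2026 the pub-hodgecm-mathlib formalisation cell (harness21).  Prover seat hodgecm-mathlib-K2-defs1 (g6), Track B, h413 = `stmt-HodgeConjecture-24833`, route `HCCMUnconditional`,
campaign «5Res (b) BL-2(χ,τ)», deals (174)∕(195) of dealer K2E1-plan (g7) (2026-09-04T11:52Z∕12:03Z): the M1 DISCHARGE of convData_χ's letters `hfam`∕`hnc` at maximal level.
-/
import Summits.HodgeConjecture.HodgeConjecture.Theorems.K2E1SphericalHeckeSmoothTestFunctionU2   -- ★ P5c FILE B (brings FILE A `sphericalWeight_*`, P5b tube lemmas, ℓ9 (a))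
import Summits.HodgeConjecture.HodgeConjecture.Theorems.K2E1BLSelfConvolutionU2                -- ★ `tsupport_selfConv_subset`, `selfConv_mul_left`, `selfConv_one_ne_zero`, `integral_selfConv_mul_borelHeight_cpow_cm`, …
import Summits.HodgeConjecture.HodgeConjecture.Theorems.K2E1SphericalTransformLevelSetsCountableU -- ★ T7 `exists_sphericalTransform_ne` (non-constancy); brings ★ `exists_ne_zero_one_lt_borelHeight`, `one_mem_closure_setOf_one_lt_borelHeight_two`
import Summits.HodgeConjecture.HodgeConjecture.Theorems.K2E1ChiSectionSpaceU2Defs               -- ★ row 9 (this seat): `chiSectionSpace`, `mem_chiSectionSpace_iff`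
import Summits.HodgeConjecture.HodgeConjecture.Theorems.K2E1ArchTestFunctionSymbolU2            -- ★ (174) P1 (this seat): §1 `exists_entire_symbol_of_arch` (general `(K′, ω)`; re-exported by name only)
import Literature.NumberTheory.Automorphic.UnitaryGroupAdelicProduct                          -- ★ `archPart`∕`finPart`, `archToAdelic_mul_finAdelicToAdelic`, `coe_archPart`∕`coe_finPart`
import HarnessLib

/-!
# (174)∕(195) — `K2E1ChiConvDataLettersMaximalLevelU2`: convData_χ's LETTERS `hfam`∕`hnc` DISCHARGED AT MAXIMAL LEVEL — for `V = V(χ, K, 1)` (`K = val⁻¹(K_∞·GL_N(𝒪̂_E))`, trivial `K`-type,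
# `χ_∞ = 1` in the form `φ ∘ ι = φ(1)` on `V`) the symmetric smooth spherical test functions `h = η ∗ η` of ★ P5c act on every `f_z^φ`, `φ ∈ V`, by the SPHERICAL TRANSFORM `ĥ(z)`:
# entire, `ĥ(z₀) = η̂(z₀)² ≠ 0`, non-constant

Cell `pub/hodgecm-mathlib`, crux H413 = `stmt-HodgeConjecture-24833`.  THEOREMS ONLY (no `def`, no `instance`, no notation, no named-fact hypothesis, no `sorry`); lane `--supports
stmt-HodgeConjecture-24833 --as helper` (count-neutral).  Closes no socket.  §1–§3 generic `(F, E, c)`, every rank; §4 HEADS in the CM packaging `(L⁺, L, conj)`, `N = 2` = the byte shape of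
★ `K2E1ChiConvDataCMTwo.exists_chi_convData_cm_two`'s binders `hfam`∕`hnc` (K2E1-p14 R4) at `V := chiSectionSpace χ K (fun _ => 1)`.

THE MATHEMATICS ([Langlands1976, §6]; [MoeglinWaldspurger1995, II.1.2]; [BernsteinLapid2019, §4 Claim 1]).  §1 re-runs ★ P5c's construction `η(g) = φ(Q(g_∞ᴴ − g_∞⁻¹))·𝟙[g_f ∈ GL_N(𝒪̂_E)]`
(`Re η̂(z₀) > 0`, bi-`K`-invariant, `≥ 0`, symmetric) EXPORTING the support clause `η(val x) ≠ 0 ⟹ (val x)_f ∈ GL_N(𝒪̂_E)` hidden in ★'s ∃-package.  §2: hence `h = η ∗ η` (★ `K2E1BLSelfConvolutionU2`)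
is supported in `{x_f ∈ GL_N(𝒪̂_E)}` (`supp(η∗η) ⊆ supp η·supp η`, a clopen subgroup condition), and a section `φ ∈ V(χ, K, 1)` with `φ ∘ ι = φ(1)` (χ_∞ = 1, ω = 1) is CONSTANT `= φ(1)` there
(`x = ι(x_∞)·ι_f(x_f)`, `ι_f(x_f) ∈ K`).  §3: for `φ ∈ V` and left-`K`-invariant `h` so supported, `∫ h(y) f_z^φ(x y) dy = ĥ(z)·f_z^φ(x)`: write `x = bk` (★ adelic Iwasawa), pull `b` out
(`χ(b₀₀)‖b‖^{−z}`-equivariance), substitute `y ↦ k⁻¹y` (left Haar, left-`K`-invariance of `h`), and use `f_z^φ = φ(1)·H^z` on `supp h`, `f_z^φ(k) = φ(1)`.  §4: with ★ `ĥ = η̂²` (CM), ★ ℓ9 (a)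
(`ĥ` entire) and ★ T7 (`ĥ` non-constant: `h ≥ 0` real, `h(1) ≠ 0`, `1 ∈ closure{H > 1}` at `N = 2`) the letters follow with `s := ĥ`.
§1 `exists_symm_sphericalWeight_supported_re_integral_pos`; §2 `sndHom_mem_of_selfConv_ne_zero`, `apply_eq_apply_one_of_sndHom_mem`; §3 `integral_selfConv_mul_flatSectionU_eq_sphericalTransform_mul`;
§4 (CM, `N = 2`) HEADS **`hfam_maximalLevel_cm_two`**, **`hnc_maximalLevel_cm_two`**.  NOT here: general `(χ_∞, ω)` (letters P2 «tube with phase» ∕ P3 «Laplace» of D4′c).  HONEST LABEL: HC_CM is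
proved only modulo the 7 printed citations (2 remaining named inputs: hLiu418 = `stmt-HodgeConjecture-24832`, h413 = `stmt-HodgeConjecture-24833`) until rung 0 closes; count-neutral.

## References
* [Langlands1976] R. P. Langlands, *On the Functional Equations Satisfied by Eisenstein Series*, LNM 544 (1976), §6.  * [MoeglinWaldspurger1995] C. Mœglin, J.-L. Waldspurger, *Spectral
  Decomposition and Eisenstein Series* (1995), II.1.2.  * [BernsteinLapid2019] J. Bernstein, E. Lapid, *On the meromorphic continuation of Eisenstein series*, J. AMS 37 (2024), §4 Claim 1.
-/

set_option autoImplicit false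
set_option linter.dupNamespace false  -- the mandated namespace repeats the summit's segment (`HodgeConjecture.HodgeConjecture`)

noncomputable section

open MeasureTheory Measure NumberField NumberField.mixedEmbedding IsDedekindDomain Set Filter Complex Topology
open scoped ENNReal NNReal MatrixGroups Matrix Classical Pointwise
open Literature.NumberTheory Literature.NumberTheory.Automorphic Literature.NumberTheory.Automorphic.UnitaryGroup
open AdelicGroupData
open Literature.NumberTheory.GaloisRepresentations (HeckeCharacter)
open Summit.HodgeConjecture.HodgeConjecture.Cruxes.H413.K2E1SphericalHeckeEigenSectionU2
open Summit.HodgeConjecture.HodgeConjecture.Cruxes.H413.K2E1SphericalHeckeGoodTestFunctionU2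
open Summit.HodgeConjecture.HodgeConjecture.Cruxes.H413.K2E1HeightFunctionU3 (borelHeight_one)
open Summit.HodgeConjecture.HodgeConjecture.Cruxes.H413.K2E1SphericalTestFunctionGL
open Summit.HodgeConjecture.HodgeConjecture.Cruxes.H413.K2E1BLSelfConvolutionU2
open Summit.HodgeConjecture.HodgeConjecture.Cruxes.H413.K2E1BorelEisensteinU
open Summit.HodgeConjecture.HodgeConjecture.Cruxes.H413.K2E1CharacterEisensteinU2Defs
open Summit.HodgeConjecture.HodgeConjecture.Cruxes.H413.K2E1ChiSectionSpaceU2Defs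
open Summit.HodgeConjecture.HodgeConjecture.Cruxes.H413.K2E1BLUniquenessU2 (exists_ne_zero_one_lt_borelHeight one_mem_closure_setOf_one_lt_borelHeight_two)
open Summit.HodgeConjecture.HodgeConjecture.Cruxes.H413.K2E1SphericalTransformLevelSetsCountableU (exists_sphericalTransform_ne)

namespace Summit.HodgeConjecture.HodgeConjecture.Cruxes.H413.K2E1ChiConvDataLettersMaximalLevelU2

/-! ## §1 ★ P5c's symmetric smooth spherical test function, with its SUPPORT CLAUSE exported -/

section TestFunction

variable {F E : Type} [Field F] [NumberField F] [Field E] [NumberField E] [Algebra F E] {c : E ≃ₐ[F] E}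
variable {N : ℕ} [NeZero N]
variable [MeasurableSpace (quasiSplit F E c N).Adelic] [BorelSpace (quasiSplit F E c N).Adelic]

/-- **★ P5c RE-RUN WITH THE SUPPORT CLAUSE**: the symmetric smooth good spherical test function of ★ `exists_symm_isTestFunctionGL_biInvariant_re_integral_pos` — `η ≥ 0`, `η(1) = 1`,
`η(g⁻¹) = η(g)`, bi-`K_GL`-invariant, `Re η̂(z₀) > 0` — TOGETHER WITH `η(val x) ≠ 0 ⟹ (val x)_f ∈ GL_N(𝒪̂_E)` (the finite factor of `η = φ(Q(g_∞ᴴ − g_∞⁻¹))·𝟙[g_f ∈ GL_N(𝒪̂_E)]`;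
proof verbatim ★'s, the clause is its internal `hx2`). [cite: Langlands1976, §6 p. 167] [cite: MoeglinWaldspurger1995, II.1.2] -/
theorem exists_symm_sphericalWeight_supported_re_integral_pos (μ : Measure (quasiSplit F E c N).Adelic) [IsFiniteMeasureOnCompacts μ] [μ.IsOpenPosMeasure] (z₀ : ℂ) :
    ∃ η : GL (Fin N) (AdeleRing (𝓞 E) E) → ℝ, IsTestFunctionGL N E η ∧ (∀ g, 0 ≤ η g) ∧ η 1 = 1 ∧ (∀ g, η g⁻¹ = η g) ∧
      (∀ κ₁ ∈ standardMaximalCompactGL N E, ∀ κ₂ ∈ standardMaximalCompactGL N E, ∀ g, η (κ₁ * g * κ₂) = η g) ∧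
      (∀ k₁ k₂ : (quasiSplit F E c N).Adelic, adelicVal F E c N ((StdForm.antidiagonal N).over E) k₁ ∈ standardMaximalCompactGL N E → adelicVal F E c N ((StdForm.antidiagonal N).over E) k₂ ∈ standardMaximalCompactGL N E →
        ∀ x, η (adelicVal F E c N ((StdForm.antidiagonal N).over E) (k₁ * x * k₂)) = η (adelicVal F E c N ((StdForm.antidiagonal N).over E) x)) ∧
      (∀ x : (quasiSplit F E c N).Adelic, η (adelicVal F E c N ((StdForm.antidiagonal N).over E) x) ≠ 0 →
        GLn.sndHom N E (adelicVal F E c N ((StdForm.antidiagonal N).over E) x) ∈ glFiniteIntegralLevel N E) ∧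
      0 < (∫ x, ((η (adelicVal F E c N ((StdForm.antidiagonal N).over E) x) : ℝ) : ℂ) * (((borelHeight x : ℝ≥0) : ℝ) : ℂ) ^ z₀ ∂μ).re := by
  haveI := t2Space_quasiSplitAdelic (F := F) (E := E) (c := c) (N := N)
  haveI := locallyCompactSpace_quasiSplitAdelic (F := F) (E := E) (c := c) (N := N)
  haveI := secondCountableTopology_quasiSplitAdelic (F := F) (E := E) (c := c) (N := N)
  have hemb : IsClosedEmbedding (adelicVal F E c N ((StdForm.antidiagonal N).over E)) := (isClosed_adelic F E c N ((StdForm.antidiagonal N).over E)).isClosedEmbedding_subtypeVal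
  set KU : Set (quasiSplit F E c N).Adelic :=
    (((standardMaximalCompactGL N E).comap (adelicVal F E c N ((StdForm.antidiagonal N).over E)) : Subgroup (quasiSplit F E c N).Adelic) : Set (quasiSplit F E c N).Adelic) with hKUdef
  obtain ⟨V, hV, hKV⟩ := exists_nhds_forall_abs_mul_log_borelHeight_lt (F := F) (E := E) (c := c) (N := N) z₀
  set W : Set (quasiSplit F E c N).Adelic := KU * interior V with hWdef
  have hWo : IsOpen W := isOpen_interior.mul_left
  have hKW : KU ⊆ W := fun k hk => ⟨k, hk, 1, mem_interior_iff_mem_nhds.2 hV, mul_one k⟩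
  set D : (quasiSplit F E c N).Adelic → ℝ := fun x => hsQ (((GLn.toMixed N E (adelicVal F E c N ((StdForm.antidiagonal N).over E) x) : GL (Fin N) (mixedSpace E)) : Matrix (Fin N) (Fin N) (mixedSpace E))ᴴ - (((GLn.toMixed N E (adelicVal F E c N ((StdForm.antidiagonal N).over E) x))⁻¹ : GL (Fin N) (mixedSpace E)) : Matrix (Fin N) (Fin N) (mixedSpace E))) with hDdef
  have hDc : Continuous D := continuous_hsQ_defect.comp ((GLn.continuous_toMixed N E).comp hemb.continuous)
  have hsndc : Continuous fun x : (quasiSplit F E c N).Adelic => GLn.sndHom N E (adelicVal F E c N ((StdForm.antidiagonal N).over E) x) := (GLn.continuous_sndHom (n := N) (K := E)).comp hemb.continuous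
  set T : {r : ℝ // 0 < r} → Set (quasiSplit F E c N).Adelic := fun r => {x | D x ≤ (r : ℝ) ∧ GLn.sndHom N E (adelicVal F E c N ((StdForm.antidiagonal N).over E) x) ∈ glFiniteIntegralLevel N E} with hTdef
  have hTclosed : ∀ r, IsClosed (T r) := fun r =>
    (isClosed_le hDc continuous_const).inter (((glFiniteIntegralLevel N E).isClosed_of_isOpen (isOpen_glFiniteIntegralLevel N E)).preimage hsndc)
  have hTcpt : ∀ r, IsCompact (T r) := by
    intro r
    have hC : IsCompact ((GLn.ofInfinite N E '' {y : GL (Fin N) (mixedSpace E) | hsQ ((y : Matrix (Fin N) (Fin N) (mixedSpace E))ᴴ - ((y⁻¹ : GL (Fin N) (mixedSpace E)) : Matrix (Fin N) (Fin N) (mixedSpace E))) ≤ (r : ℝ)}) *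
        (GLn.ofFinite N E '' (glFiniteIntegralLevel N E : Set (GL (Fin N) (FiniteAdeleRing (𝓞 E) E))))) :=
      ((isCompact_setOf_hsQ_defect_le (n := N) (K := E) (r : ℝ)).image (GLn.continuous_ofInfinite N E)).mul
        ((isCompact_glFiniteIntegralLevel_holds N E).image (GLn.continuous_ofFinite N E))
    refine (hemb.isCompact_preimage hC).of_isClosed_subset (hTclosed r) fun x hx => ?_
    rw [Set.mem_preimage, ← GLn.ofInfinite_toMixed_mul_ofFinite_sndHom (adelicVal F E c N ((StdForm.antidiagonal N).over E) x)]
    exact Set.mul_mem_mul (Set.mem_image_of_mem _ hx.1) (Set.mem_image_of_mem _ hx.2)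
  have hTdir : Directed (· ⊇ ·) T := by
    intro r₁ r₂
    refine ⟨⟨min (r₁ : ℝ) r₂, lt_min r₁.2 r₂.2⟩, fun x hx => ⟨hx.1.trans (min_le_left _ _), hx.2⟩, fun x hx => ⟨hx.1.trans (min_le_right _ _), hx.2⟩⟩
  have hTint : ∀ x ∈ ⋂ r, T r, x ∈ KU := by
    intro x hx
    rw [Set.mem_iInter] at hx
    have hD0 : D x = 0 := by
      refine le_antisymm (le_of_forall_pos_le_add fun ε hε => ?_) (hsQ_nonneg _)
      have h := (hx ⟨ε, hε⟩).1
      rw [zero_add]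
      exact h
    have hinf : GLn.toMixed N E (adelicVal F E c N ((StdForm.antidiagonal N).over E) x) ∈ Kinf N E := by
      rw [Kinf_eq_unitarySubgroupGL, mem_unitarySubgroupGL_iff]
      exact star_mul_self_eq_one_of_hsQ_defect_eq_zero hD0
    exact Subgroup.mem_comap.2 ((mem_standardMaximalCompactGL_iff_toMixed_sndHom _).2 ⟨hinf, (hx ⟨1, one_pos⟩).2⟩)
  haveI : Nonempty {r : ℝ // 0 < r} := ⟨⟨1, one_pos⟩⟩
  obtain ⟨r, hr⟩ := exists_subset_nhds_of_isCompact' hTdir hTcpt hTclosed (U := W) fun x hx => hWo.mem_nhds (hKW (hTint x hx))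
  let φ : ContDiffBump (0 : ℝ) := ⟨(r : ℝ) / 2, r, half_pos r.2, half_lt_self r.2⟩
  have hφr : φ.rOut = (r : ℝ) := rfl
  set η : GL (Fin N) (AdeleRing (𝓞 E) E) → ℝ := fun g => adelicWeight (glFiniteIntegralLevel N E) (fun y : GL (Fin N) (mixedSpace E) => φ (hsQ ((y : Matrix (Fin N) (Fin N) (mixedSpace E))ᴴ - ((y⁻¹ : GL (Fin N) (mixedSpace E)) : Matrix (Fin N) (Fin N) (mixedSpace E))))) g with hηdef
  have hηt : IsTestFunctionGL N E η := isTestFunctionGL_sphericalWeight φ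
  have hη0 : ∀ g, 0 ≤ η g := fun g => sphericalWeight_nonneg φ g
  have hη1 : η 1 = 1 := sphericalWeight_one φ
  have hηinv : ∀ g, η g⁻¹ = η g := fun g => sphericalWeight_inv φ g
  have hηK : ∀ κ₁ ∈ standardMaximalCompactGL N E, ∀ κ₂ ∈ standardMaximalCompactGL N E, ∀ g, η (κ₁ * g * κ₂) = η g :=
    fun κ₁ h₁ κ₂ h₂ g => sphericalWeight_mul_mul φ h₁ h₂ g
  have hηKU : ∀ k₁ k₂ : (quasiSplit F E c N).Adelic, adelicVal F E c N ((StdForm.antidiagonal N).over E) k₁ ∈ standardMaximalCompactGL N E → adelicVal F E c N ((StdForm.antidiagonal N).over E) k₂ ∈ standardMaximalCompactGL N E →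
      ∀ x, η (adelicVal F E c N ((StdForm.antidiagonal N).over E) (k₁ * x * k₂)) = η (adelicVal F E c N ((StdForm.antidiagonal N).over E) x) := fun k₁ k₂ h₁ h₂ x => by
    rw [map_mul, map_mul]; exact hηK _ h₁ _ h₂ _
  have htube : ∀ x, η (adelicVal F E c N ((StdForm.antidiagonal N).over E) x) ≠ 0 → |z₀.im * Real.log ((borelHeight x : ℝ≥0) : ℝ)| < 1 := by
    intro x hx
    simp only [hηdef] at hx
    rw [sphericalWeight_apply] at hx
    have hx1 := left_ne_zero_of_mul hx
    have hx2 : GLn.sndHom N E (adelicVal F E c N ((StdForm.antidiagonal N).over E) x) ∈ glFiniteIntegralLevel N E := by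
      by_contra h2
      rw [if_neg h2, mul_zero] at hx
      exact hx rfl
    have hxT : x ∈ T r := ⟨(hφr ▸ hsQ_defect_lt_of_bump_ne_zero φ hx1).le, hx2⟩
    obtain ⟨k, hk, u, hu, rfl⟩ := hr hxT
    exact hKV k (Subgroup.mem_comap.1 hk) u (interior_subset hu)
  set h : (quasiSplit F E c N).Adelic → ℝ := fun x => η (adelicVal F E c N ((StdForm.antidiagonal N).over E) x) with hh
  have hhc : Continuous h := hηt.continuous.comp hemb.continuous
  have hhs : HasCompactSupport h := hηt.hasCompactSupport.comp_isClosedEmbedding hemb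
  have hhnn : ∀ x, 0 ≤ h x := fun x => hη0 _
  set g : (quasiSplit F E c N).Adelic → ℝ := fun x =>
    h x * ((((borelHeight x : ℝ≥0) : ℝ) ^ z₀.re) * Real.cos (z₀.im * Real.log ((borelHeight x : ℝ≥0) : ℝ))) with hg
  have hgc : Continuous g :=
    hhc.mul ((continuous_borelHeight_coe.rpow_const fun x => Or.inl (borelHeight_coe_pos x).ne').mul
      (Real.continuous_cos.comp (continuous_mul_log_borelHeight z₀)))
  have hgs : HasCompactSupport g := hhs.mul_right
  have hgnn : ∀ x, 0 ≤ g x := by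
    intro x
    by_cases hx : h x = 0
    · simp only [hg, hx, zero_mul, le_refl]
    · exact mul_nonneg (hhnn x) (mul_nonneg (Real.rpow_nonneg (borelHeight_coe_pos x).le _)
        (cos_pos_of_abs_le_one (htube x hx).le).le)
  have hg1 : g 1 ≠ 0 := by
    have h1 : h 1 = 1 := by
      show η (adelicVal F E c N ((StdForm.antidiagonal N).over E) 1) = 1
      rw [map_one]; exact hη1
    simp only [hg, h1, borelHeight_one, NNReal.coe_one, Real.one_rpow, Real.log_one, mul_zero, Real.cos_zero, mul_one]
    exact one_ne_zero
  have hpos : 0 < ∫ x, g x ∂μ := hgc.integral_pos_of_hasCompactSupport_nonneg_nonzero hgs hgnn hg1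
  have hint : Integrable (fun x => (h x : ℂ) * (((borelHeight x : ℝ≥0) : ℝ) : ℂ) ^ z₀) μ :=
    (continuous_mul_borelHeight_cpow (continuous_ofReal.comp hhc) z₀).integrable_of_hasCompactSupport ((hhs.comp_left ofReal_zero).mul_right)
  have hre : (∫ x, (h x : ℂ) * (((borelHeight x : ℝ≥0) : ℝ) : ℂ) ^ z₀ ∂μ).re = ∫ x, g x ∂μ := by
    rw [← RCLike.re_to_complex, ← integral_re hint]
    refine integral_congr_ae (Eventually.of_forall fun x => ?_)
    simp only [RCLike.re_to_complex, re_ofReal_mul, re_ofReal_cpow_of_pos (borelHeight_coe_pos x), hg]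
  have hsuppf : ∀ x : (quasiSplit F E c N).Adelic, η (adelicVal F E c N ((StdForm.antidiagonal N).over E) x) ≠ 0 →
      GLn.sndHom N E (adelicVal F E c N ((StdForm.antidiagonal N).over E) x) ∈ glFiniteIntegralLevel N E := by
    intro x hx
    simp only [hηdef] at hx
    rw [sphericalWeight_apply] at hx
    by_contra h2
    rw [if_neg h2, mul_zero] at hx
    exact hx rfl
  refine ⟨η, hηt, hη0, hη1, hηinv, hηK, hηKU, hsuppf, ?_⟩
  show 0 < (∫ x, (h x : ℂ) * (((borelHeight x : ℝ≥0) : ℝ) : ℂ) ^ z₀ ∂μ).re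
  rw [hre]
  exact hpos

/-! ## §2 The self-convolution is supported in `{x_f ∈ GL_N(𝒪̂_E)}`; sections with `φ ∘ ι = φ(1)` are constant there -/

omit [NeZero N] [BorelSpace (quasiSplit F E c N).Adelic] in
/-- **SUPPORT OF `h = η ∗ η`**: if `η(val x) ≠ 0 ⟹ (val x)_f ∈ GL_N(𝒪̂_E)`, then `(η∗η)(y) ≠ 0 ⟹ (val y)_f ∈ GL_N(𝒪̂_E)` (★ `tsupport_selfConv_subset`: `supp(η∗η) ⊆ supp η·supp η`; the condition
defines a CLOSED subgroup — preimage of the clopen `GL_N(𝒪̂_E)`). [folklore] -/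
theorem sndHom_mem_of_selfConv_ne_zero (νG : Measure (quasiSplit F E c N).Adelic) {η₀ : GL (Fin N) (AdeleRing (𝓞 E) E) → ℝ} (hηt : IsTestFunctionGL N E η₀)
    (hsupp : ∀ x : (quasiSplit F E c N).Adelic, η₀ (adelicVal F E c N ((StdForm.antidiagonal N).over E) x) ≠ 0 →
      GLn.sndHom N E (adelicVal F E c N ((StdForm.antidiagonal N).over E) x) ∈ glFiniteIntegralLevel N E)
    {y : (quasiSplit F E c N).Adelic}
    (hy : orbitalSmoothing νG (fun x : (quasiSplit F E c N).Adelic => ((η₀ (adelicVal F E c N ((StdForm.antidiagonal N).over E) x) : ℝ) : ℂ))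
      (fun x : (quasiSplit F E c N).Adelic => ((η₀ (adelicVal F E c N ((StdForm.antidiagonal N).over E) x) : ℝ) : ℂ)) y ≠ 0) :
    GLn.sndHom N E (adelicVal F E c N ((StdForm.antidiagonal N).over E) y) ∈ glFiniteIntegralLevel N E := by
  have hemb : IsClosedEmbedding (adelicVal F E c N ((StdForm.antidiagonal N).over E)) := (isClosed_adelic F E c N ((StdForm.antidiagonal N).over E)).isClosedEmbedding_subtypeVal
  have hsndc : Continuous fun x : (quasiSplit F E c N).Adelic => GLn.sndHom N E (adelicVal F E c N ((StdForm.antidiagonal N).over E) x) :=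
    (GLn.continuous_sndHom (n := N) (K := E)).comp hemb.continuous
  set S : Set (quasiSplit F E c N).Adelic := {x | GLn.sndHom N E (adelicVal F E c N ((StdForm.antidiagonal N).over E) x) ∈ glFiniteIntegralLevel N E} with hS
  have hSc : IsClosed S := ((glFiniteIntegralLevel N E).isClosed_of_isOpen (isOpen_glFiniteIntegralLevel N E)).preimage hsndc
  have hηs : HasCompactSupport fun x : (quasiSplit F E c N).Adelic => ((η₀ (adelicVal F E c N ((StdForm.antidiagonal N).over E) x) : ℝ) : ℂ) :=
    (hηt.hasCompactSupport.comp_isClosedEmbedding hemb).comp_left Complex.ofReal_zero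
  have hts : tsupport (fun x : (quasiSplit F E c N).Adelic => ((η₀ (adelicVal F E c N ((StdForm.antidiagonal N).over E) x) : ℝ) : ℂ)) ⊆ S :=
    closure_minimal (fun x hx => hsupp x fun h0 => hx (by show ((η₀ _ : ℝ) : ℂ) = 0; rw [h0, Complex.ofReal_zero])) hSc
  obtain ⟨y₁, hy₁, y₂, hy₂, rfl⟩ := tsupport_selfConv_subset νG hηs (subset_tsupport _ hy)
  rw [map_mul, map_mul]
  exact (glFiniteIntegralLevel N E).mul_mem (hts hy₁) (hts hy₂)

omit [MeasurableSpace (quasiSplit F E c N).Adelic] [BorelSpace (quasiSplit F E c N).Adelic] in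
/-- **SECTIONS OF `V(χ, K, 1)` WITH `φ ∘ ι = φ(1)` ARE CONSTANT ON `{x_f ∈ GL_N(𝒪̂_E)}`**: `x = ι(x_∞)·ι_f(x_f)` (★ `archToAdelic_mul_finAdelicToAdelic`), `ι_f(x_f) ∈ K` (its archimedean
component is `1 ∈ K_∞`), right-`K`-invariance (trivial `K`-type) and the hypothesis `φ(ι a) = φ(1)` (χ_∞ = 1). [folklore] -/
theorem apply_eq_apply_one_of_sndHom_mem {χ : HeckeCharacter E} {φ : (quasiSplit F E c N).Adelic → ℂ}
    (hφ : φ ∈ chiSectionSpace χ (((standardMaximalCompactGL N E).comap (adelicVal F E c N ((StdForm.antidiagonal N).over E)) : Subgroup (quasiSplit F E c N).Adelic)) (fun _ => 1))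
    (hφinf : ∀ a : arch F E c N ((StdForm.antidiagonal N).over E), φ (archToAdelic F E c N _ a) = φ 1)
    {y : (quasiSplit F E c N).Adelic} (hy : GLn.sndHom N E (adelicVal F E c N ((StdForm.antidiagonal N).over E) y) ∈ glFiniteIntegralLevel N E) : φ y = φ 1 := by
  have hk : finAdelicToAdelic F E c N ((StdForm.antidiagonal N).over E) (finPart F E c N _ y) ∈
      (((standardMaximalCompactGL N E).comap (adelicVal F E c N ((StdForm.antidiagonal N).over E)) : Subgroup (quasiSplit F E c N).Adelic)) := by
    refine Subgroup.mem_comap.2 ((mem_standardMaximalCompactGL_iff_toMixed_sndHom _).2 ⟨?_, ?_⟩)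
    · rw [show GLn.toMixed N E (adelicVal F E c N ((StdForm.antidiagonal N).over E) (finAdelicToAdelic F E c N _ (finPart F E c N _ y))) =
          ((archPart F E c N _ (finAdelicToAdelic F E c N _ (finPart F E c N _ y)) : arch F E c N ((StdForm.antidiagonal N).over E)) : GL (Fin N) (mixedSpace E)) from rfl,
        archPart_finAdelicToAdelic]
      exact (Kinf N E).one_mem
    · rw [show GLn.sndHom N E (adelicVal F E c N ((StdForm.antidiagonal N).over E) (finAdelicToAdelic F E c N _ (finPart F E c N _ y))) =
          ((finPart F E c N _ (finAdelicToAdelic F E c N _ (finPart F E c N _ y)) : finAdelic F E c N ((StdForm.antidiagonal N).over E)) : GL (Fin N) (FiniteAdeleRing (𝓞 E) E)) from rfl,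
        finPart_finAdelicToAdelic]
      exact hy
  have e := ((mem_chiSectionSpace_iff _).1 hφ).2 (archToAdelic F E c N _ (archPart F E c N _ y)) ⟨_, hk⟩
  rw [archToAdelic_mul_finAdelicToAdelic, one_mul, hφinf] at e
  exact e

end TestFunction

/-! ## §3 A left-`K`-invariant test function supported in `{x_f ∈ GL_N(𝒪̂_E)}` acts on `f_z^φ`, `φ ∈ V(χ, K, 1)`, by its spherical transform -/

section Action

variable {F E : Type} [Field F] [NumberField F] [Field E] [NumberField E] [Algebra F E] {c : E ≃ₐ[F] E}
variable {N : ℕ} [NeZero N]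
variable [MeasurableSpace (quasiSplit F E c N).Adelic] [BorelSpace (quasiSplit F E c N).Adelic]

/-- **`∫ h(y)·f_z^φ(x y) dν_G = ĥ(z)·f_z^φ(x)`** for `φ ∈ V(χ, K, 1)` with `φ ∘ ι = φ(1)`, `h` left-`K`-invariant and supported in `{y_f ∈ GL_N(𝒪̂_E)}`, `ν_G` left-invariant, given the adelic Iwasawa
decomposition `hBK` (★ `exists_mem_borelAdelic_mul_mem_standardMaximalCompactGL[_cm]`): `x = bk`; pull `b` out (`χ(b₀₀)(‖b₁₁‖⁻¹)^z`, ★ `flatSectionU_borel_mul_of_isChiSection`); `y ↦ k⁻¹y`; on `supp h`,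
`f_z^φ = φ(1)·H^z` (§2); and `f_z^φ(k) = φ(1)` (`H(k) = 1`). [cite: Langlands1976, §6 (p. 167)] [cite: BernsteinLapid2019, §4 Claim 1] -/
theorem integral_selfConv_mul_flatSectionU_eq_sphericalTransform_mul (νG : Measure (quasiSplit F E c N).Adelic) [νG.IsMulLeftInvariant]
    (hBK : ∀ g : (quasiSplit F E c N).Adelic, ∃ b ∈ borelAdelic F E c N, ∃ k : (quasiSplit F E c N).Adelic,
      adelicVal F E c N ((StdForm.antidiagonal N).over E) k ∈ standardMaximalCompactGL N E ∧ g = b * k)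
    {χ : HeckeCharacter E} {φ : (quasiSplit F E c N).Adelic → ℂ}
    (hφ : φ ∈ chiSectionSpace χ (((standardMaximalCompactGL N E).comap (adelicVal F E c N ((StdForm.antidiagonal N).over E)) : Subgroup (quasiSplit F E c N).Adelic)) (fun _ => 1))
    (hφinf : ∀ a : arch F E c N ((StdForm.antidiagonal N).over E), φ (archToAdelic F E c N _ a) = φ 1)
    {h : (quasiSplit F E c N).Adelic → ℂ}
    (hKh : ∀ k : (quasiSplit F E c N).Adelic, adelicVal F E c N ((StdForm.antidiagonal N).over E) k ∈ standardMaximalCompactGL N E → ∀ y, h (k * y) = h y)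
    (hsupp : ∀ y, h y ≠ 0 → GLn.sndHom N E (adelicVal F E c N ((StdForm.antidiagonal N).over E) y) ∈ glFiniteIntegralLevel N E) (z : ℂ) (x : (quasiSplit F E c N).Adelic) :
    ∫ y, h y * flatSectionU φ z (x * y) ∂νG = (∫ y, h y * (((borelHeight y : ℝ≥0) : ℝ) : ℂ) ^ z ∂νG) * flatSectionU φ z x := by
  obtain ⟨b, hb, k, hk, rfl⟩ := hBK x
  -- on `supp h`, `f_z^φ(y) = φ(1)·H(y)^z`
  have hpt : ∀ y, h y * flatSectionU φ z y = (h y * (((borelHeight y : ℝ≥0) : ℝ) : ℂ) ^ z) * φ 1 := fun y => by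
    by_cases hy : h y = 0
    · rw [hy, zero_mul, zero_mul, zero_mul]
    · rw [flatSectionU_apply, apply_eq_apply_one_of_sndHom_mem hφ hφinf (hsupp y hy)]; ring
  -- `∫ h(y) f(k y) dy = ∫ h(y) f(y) dy` (left Haar, left-`K`-invariance of `h`)
  have hshift : ∫ y, h y * flatSectionU φ z (k * y) ∂νG = ∫ y, h y * flatSectionU φ z y ∂νG := by
    have e := integral_mul_left_eq_self (μ := νG) (fun y => h (k⁻¹ * y) * flatSectionU φ z y) k
    simp only [inv_mul_cancel_left] at e
    rw [e]
    refine integral_congr_ae (Eventually.of_forall fun y => ?_)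
    have hk' : adelicVal F E c N ((StdForm.antidiagonal N).over E) k⁻¹ ∈ standardMaximalCompactGL N E := by rw [map_inv]; exact inv_mem hk
    show h (k⁻¹ * y) * flatSectionU φ z y = h y * flatSectionU φ z y
    rw [hKh k⁻¹ hk' y]
  have hfk : flatSectionU φ z k = φ 1 := by
    have e := ((mem_chiSectionSpace_iff _).1 hφ).2 1 ⟨k, Subgroup.mem_comap.2 hk⟩
    rw [one_mul, one_mul] at e
    rw [flatSectionU_apply, e, borelHeight_eq_one_of_mem hk, NNReal.coe_one, Complex.ofReal_one, Complex.one_cpow, mul_one]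
  simp_rw [mul_assoc b k, flatSectionU_borel_mul_of_isChiSection hφ.1 z hb]
  simp_rw [show ∀ y, h y * (((χ (firstEntryUnit hb) : ℂˣ) : ℂ) * ((((IdeleClassGroup.ideleNorm E (lastEntryUnit hb))⁻¹ : ℝ≥0) : ℝ) : ℂ) ^ z * flatSectionU φ z (k * y)) =
      (((χ (firstEntryUnit hb) : ℂˣ) : ℂ) * ((((IdeleClassGroup.ideleNorm E (lastEntryUnit hb))⁻¹ : ℝ≥0) : ℝ) : ℂ) ^ z) * (h y * flatSectionU φ z (k * y)) from fun y => by ring]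
  rw [integral_const_mul, hshift, integral_congr_ae (Eventually.of_forall hpt), integral_mul_const, hfk]
  ring

end Action

/-! ## §4 HEADS (CM, `N = 2`): convData_χ's letters `hfam`∕`hnc` at `V := chiSectionSpace χ K 1`, `χ_∞ = 1` -/

section Heads

variable (L : Type) [Field L] [NumberField L] [IsCMField L]
variable [MeasurableSpace (quasiSplit (↥(maximalRealSubfield L)) L (IsCMField.complexConj L) 2).Adelic] [BorelSpace (quasiSplit (↥(maximalRealSubfield L)) L (IsCMField.complexConj L) 2).Adelic]
variable (νG : Measure (quasiSplit (↥(maximalRealSubfield L)) L (IsCMField.complexConj L) 2).Adelic) [νG.IsHaarMeasure] [SFinite νG]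
variable {χ : HeckeCharacter L}

/-- The common core of both heads: for every `z₀` a symmetric smooth `η ≥ 0` (★ P5c) whose self-convolution `h = η ∗ η` acts on all `f_z^φ`, `φ ∈ V(χ, K, 1)` (with `φ ∘ ι = φ(1)`), by the ENTIRE
spherical transform `ĥ`, with `ĥ(z₀) ≠ 0` (`= η̂(z₀)²`, ★ `integral_selfConv_mul_borelHeight_cpow_cm`) and `ĥ` NON-CONSTANT (★ T7 `exists_sphericalTransform_ne`: `h ≥ 0` real, `h(1) ≠ 0`,
`1 ∈ closure{H > 1}`). [cite: Langlands1976, §6 (p. 167)] [cite: BernsteinLapid2019, §4 Claim 1] [cite: MoeglinWaldspurger1995, II.1.2] -/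
theorem exists_testFunction_sphericalTransform_maximalLevel_cm_two
    (hVinf : ∀ φ ∈ chiSectionSpace χ (((standardMaximalCompactGL 2 L).comap (adelicVal (↥(maximalRealSubfield L)) L (IsCMField.complexConj L) 2 ((StdForm.antidiagonal 2).over L)) :
      Subgroup (quasiSplit (↥(maximalRealSubfield L)) L (IsCMField.complexConj L) 2).Adelic)) (fun _ => 1),
      ∀ a : arch (↥(maximalRealSubfield L)) L (IsCMField.complexConj L) 2 ((StdForm.antidiagonal 2).over L), φ (archToAdelic (↥(maximalRealSubfield L)) L (IsCMField.complexConj L) 2 _ a) = φ 1)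
    (z₀ : ℂ) :
    ∃ η : GL (Fin 2) (AdeleRing (𝓞 L) L) → ℝ, IsTestFunctionGL 2 L η ∧ (∀ g, 0 ≤ η g) ∧ (∀ g, η g⁻¹ = η g) ∧
      ∃ s : ℂ → ℂ, Differentiable ℂ s ∧ s z₀ ≠ 0 ∧ (∃ z₁ z₂ : ℂ, s z₁ ≠ s z₂) ∧
        ∀ z : ℂ, ∀ φ ∈ chiSectionSpace χ (((standardMaximalCompactGL 2 L).comap (adelicVal (↥(maximalRealSubfield L)) L (IsCMField.complexConj L) 2 ((StdForm.antidiagonal 2).over L)) :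
            Subgroup (quasiSplit (↥(maximalRealSubfield L)) L (IsCMField.complexConj L) 2).Adelic)) (fun _ => 1),
          ∀ x : (quasiSplit (↥(maximalRealSubfield L)) L (IsCMField.complexConj L) 2).Adelic,
            (∫ y, (fun y : (quasiSplit (↥(maximalRealSubfield L)) L (IsCMField.complexConj L) 2).Adelic =>
                orbitalSmoothing νG (fun x : (quasiSplit (↥(maximalRealSubfield L)) L (IsCMField.complexConj L) 2).Adelic => ((η (adelicVal (↥(maximalRealSubfield L)) L (IsCMField.complexConj L) 2 ((StdForm.antidiagonal 2).over L) x) : ℝ) : ℂ))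
                  (fun x : (quasiSplit (↥(maximalRealSubfield L)) L (IsCMField.complexConj L) 2).Adelic => ((η (adelicVal (↥(maximalRealSubfield L)) L (IsCMField.complexConj L) 2 ((StdForm.antidiagonal 2).over L) x) : ℝ) : ℂ)) y) y *
              flatSectionU φ z (x * y) ∂νG) = s z * flatSectionU φ z x := by
  haveI := t2Space_quasiSplitAdelic (F := ↥(maximalRealSubfield L)) (E := L) (c := IsCMField.complexConj L) (N := 2)
  have hemb : IsClosedEmbedding (adelicVal (↥(maximalRealSubfield L)) L (IsCMField.complexConj L) 2 ((StdForm.antidiagonal 2).over L)) :=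
    (isClosed_adelic (↥(maximalRealSubfield L)) L (IsCMField.complexConj L) 2 ((StdForm.antidiagonal 2).over L)).isClosedEmbedding_subtypeVal
  obtain ⟨η, hηt, hη0, hη1, hηinv, -, hηKU, hsuppη, hre⟩ := exists_symm_sphericalWeight_supported_re_integral_pos (F := ↥(maximalRealSubfield L)) (E := L) (c := IsCMField.complexConj L) (N := 2) νG z₀
  set ηt : (quasiSplit (↥(maximalRealSubfield L)) L (IsCMField.complexConj L) 2).Adelic → ℂ :=
    fun x => ((η (adelicVal (↥(maximalRealSubfield L)) L (IsCMField.complexConj L) 2 ((StdForm.antidiagonal 2).over L) x) : ℝ) : ℂ) with hηt_def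
  have hηr_c : Continuous fun x : (quasiSplit (↥(maximalRealSubfield L)) L (IsCMField.complexConj L) 2).Adelic => η (adelicVal (↥(maximalRealSubfield L)) L (IsCMField.complexConj L) 2 ((StdForm.antidiagonal 2).over L) x) :=
    hηt.continuous.comp hemb.continuous
  have hηr_s : HasCompactSupport fun x : (quasiSplit (↥(maximalRealSubfield L)) L (IsCMField.complexConj L) 2).Adelic => η (adelicVal (↥(maximalRealSubfield L)) L (IsCMField.complexConj L) 2 ((StdForm.antidiagonal 2).over L) x) :=
    hηt.hasCompactSupport.comp_isClosedEmbedding hemb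
  have hηc : Continuous ηt := Complex.continuous_ofReal.comp hηr_c
  have hηs : HasCompactSupport ηt := hηr_s.comp_left Complex.ofReal_zero
  have hηK : ∀ k : (quasiSplit (↥(maximalRealSubfield L)) L (IsCMField.complexConj L) 2).Adelic,
      adelicVal (↥(maximalRealSubfield L)) L (IsCMField.complexConj L) 2 ((StdForm.antidiagonal 2).over L) k ∈ standardMaximalCompactGL 2 L → ∀ x, ηt (k * x) = ηt x := by
    intro k hk x
    have e := hηKU k 1 hk (by rw [map_one]; exact (standardMaximalCompactGL 2 L).one_mem) x
    rw [mul_one] at e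
    simp only [hηt_def, e]
  set h : (quasiSplit (↥(maximalRealSubfield L)) L (IsCMField.complexConj L) 2).Adelic → ℂ := fun y => orbitalSmoothing νG ηt ηt y with hh_def
  have hhc : Continuous h := continuous_selfConv νG hηc hηs
  have hhs : HasCompactSupport h := hasCompactSupport_selfConv νG hηs
  have hhK : ∀ k : (quasiSplit (↥(maximalRealSubfield L)) L (IsCMField.complexConj L) 2).Adelic,
      adelicVal (↥(maximalRealSubfield L)) L (IsCMField.complexConj L) 2 ((StdForm.antidiagonal 2).over L) k ∈ standardMaximalCompactGL 2 L → ∀ y, h (k * y) = h y :=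
    fun k hk y => selfConv_mul_left νG (K := {k | adelicVal (↥(maximalRealSubfield L)) L (IsCMField.complexConj L) 2 ((StdForm.antidiagonal 2).over L) k ∈ standardMaximalCompactGL 2 L})
      (fun k hk x => hηK k hk x) hk y
  have hhsupp : ∀ y, h y ≠ 0 → GLn.sndHom 2 L (adelicVal (↥(maximalRealSubfield L)) L (IsCMField.complexConj L) 2 ((StdForm.antidiagonal 2).over L) y) ∈ glFiniteIntegralLevel 2 L :=
    fun y hy => sndHom_mem_of_selfConv_ne_zero νG hηt hsuppη hy
  set s : ℂ → ℂ := fun z => ∫ y, h y * (((borelHeight y : ℝ≥0) : ℝ) : ℂ) ^ z ∂νG with hs_def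
  have hsd : Differentiable ℂ s := differentiable_integral_mul_borelHeight_cpow νG hhc hhs
  have hs0 : s z₀ ≠ 0 := by
    have e : s z₀ = (∫ x, ηt x * (((borelHeight x : ℝ≥0) : ℝ) : ℂ) ^ z₀ ∂νG) * (∫ x, ηt x * (((borelHeight x : ℝ≥0) : ℝ) : ℂ) ^ z₀ ∂νG) :=
      integral_selfConv_mul_borelHeight_cpow_cm L νG hηK hηc hηs z₀
    have hne : (∫ x, ηt x * (((borelHeight x : ℝ≥0) : ℝ) : ℂ) ^ z₀ ∂νG) ≠ 0 := fun h0 => hre.ne' (by simp only [hηt_def] at h0; rw [h0, Complex.zero_re])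
    rw [e]; exact mul_ne_zero hne hne
  have hreal : ∀ y, ((((h y).re : ℝ)) : ℂ) = h y := fun y =>
    (Complex.conj_eq_iff_re.1 (conj_selfConv νG (fun g => by simp only [hηt_def, Complex.conj_ofReal]) y))
  have hRc : Continuous fun y => (h y).re := Complex.continuous_re.comp hhc
  have hRs : HasCompactSupport fun y => (h y).re := hhs.comp_left Complex.zero_re
  have hη0' : ∀ g : (quasiSplit (↥(maximalRealSubfield L)) L (IsCMField.complexConj L) 2).Adelic, 0 ≤ η (adelicVal (↥(maximalRealSubfield L)) L (IsCMField.complexConj L) 2 ((StdForm.antidiagonal 2).over L) g) :=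
    fun g => hη0 _
  have hR0 : ∀ y, 0 ≤ (h y).re := fun y => selfConv_re_nonneg νG hη0' y
  have hc2 : IsCMField.complexConj L * IsCMField.complexConj L = 1 := AlgEquiv.ext fun x => IsCMField.complexConj_apply_apply L x
  have h1 : h 1 ≠ 0 :=
    selfConv_one_ne_zero νG hηr_c hηr_s hη0' (fun g => by rw [map_inv]; exact hηinv _) (g₀ := 1) (by rw [map_one, hη1]; exact one_ne_zero)
  have hR1 : (fun y => (h y).re) 1 ≠ 0 := fun h0 => h1 (by rw [← hreal 1]; simp only [h0, Complex.ofReal_zero])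
  obtain ⟨g₀, hg₀, hH⟩ := exists_ne_zero_one_lt_borelHeight hRc hR1 (one_mem_closure_setOf_one_lt_borelHeight_two hc2)
  have hnc : ∃ z₁ z₂ : ℂ, s z₁ ≠ s z₂ := by
    obtain ⟨z₁, hz₁⟩ := exists_sphericalTransform_ne νG hRc hRs hR0 hg₀ hH (s 0)
    refine ⟨z₁, 0, ?_⟩
    simpa only [hreal] using hz₁
  refine ⟨η, hηt, hη0, hηinv, s, hsd, hs0, hnc, fun z φ hφ x => ?_⟩
  exact integral_selfConv_mul_flatSectionU_eq_sphericalTransform_mul νG (exists_mem_borelAdelic_mul_mem_standardMaximalCompactGL_cm L) hφ (hVinf φ hφ) hhK hhsupp z x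

/-- **HEAD `hfam` AT MAXIMAL LEVEL** — the letter `hfam` of ★ `K2E1ChiConvDataCMTwo.exists_chi_convData_cm_two` DISCHARGED at `V := chiSectionSpace χ K (fun _ => 1)` under `χ_∞ = 1` (`φ ∘ ι = φ(1)` on
`V`): for every `z₀` a symmetric smooth `η ≥ 0` and an ENTIRE `s` (`= ĥ`, `h = η ∗ η`) with `s z₀ ≠ 0` acting on every `f_z^φ`, `φ ∈ V`. [cite: Langlands1976, §6 (p. 167)] [cite: BernsteinLapid2019, §4 Claim 1] -/
theorem hfam_maximalLevel_cm_two
    (hVinf : ∀ φ ∈ chiSectionSpace χ (((standardMaximalCompactGL 2 L).comap (adelicVal (↥(maximalRealSubfield L)) L (IsCMField.complexConj L) 2 ((StdForm.antidiagonal 2).over L)) :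
      Subgroup (quasiSplit (↥(maximalRealSubfield L)) L (IsCMField.complexConj L) 2).Adelic)) (fun _ => 1),
      ∀ a : arch (↥(maximalRealSubfield L)) L (IsCMField.complexConj L) 2 ((StdForm.antidiagonal 2).over L), φ (archToAdelic (↥(maximalRealSubfield L)) L (IsCMField.complexConj L) 2 _ a) = φ 1) :
    ∀ z₀ : ℂ, ∃ η : GL (Fin 2) (AdeleRing (𝓞 L) L) → ℝ, IsTestFunctionGL 2 L η ∧ (∀ g, 0 ≤ η g) ∧ (∀ g, η g⁻¹ = η g) ∧
      ∃ s : ℂ → ℂ, Differentiable ℂ s ∧ s z₀ ≠ 0 ∧ ∀ z : ℂ, ∀ φ ∈ chiSectionSpace χ (((standardMaximalCompactGL 2 L).comap (adelicVal (↥(maximalRealSubfield L)) L (IsCMField.complexConj L) 2 ((StdForm.antidiagonal 2).over L)) :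
      Subgroup (quasiSplit (↥(maximalRealSubfield L)) L (IsCMField.complexConj L) 2).Adelic)) (fun _ => 1), ∀ x : (quasiSplit (↥(maximalRealSubfield L)) L (IsCMField.complexConj L) 2).Adelic,
        (∫ y, (fun y : (quasiSplit (↥(maximalRealSubfield L)) L (IsCMField.complexConj L) 2).Adelic =>
            orbitalSmoothing νG (fun x : (quasiSplit (↥(maximalRealSubfield L)) L (IsCMField.complexConj L) 2).Adelic => ((η (adelicVal (↥(maximalRealSubfield L)) L (IsCMField.complexConj L) 2 ((StdForm.antidiagonal 2).over L) x) : ℝ) : ℂ))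
              (fun x : (quasiSplit (↥(maximalRealSubfield L)) L (IsCMField.complexConj L) 2).Adelic => ((η (adelicVal (↥(maximalRealSubfield L)) L (IsCMField.complexConj L) 2 ((StdForm.antidiagonal 2).over L) x) : ℝ) : ℂ)) y) y *
          flatSectionU φ z (x * y) ∂νG) = s z * flatSectionU φ z x := by
  intro z₀
  obtain ⟨η, h1, h2, h3, s, hs, hs0, -, hact⟩ := exists_testFunction_sphericalTransform_maximalLevel_cm_two L νG hVinf z₀
  exact ⟨η, h1, h2, h3, s, hs, hs0, hact⟩

/-- **HEAD `hnc` AT MAXIMAL LEVEL** — the letter `hnc` of ★ `exists_chi_convData_cm_two` DISCHARGED at `V := chiSectionSpace χ K (fun _ => 1)` under `χ_∞ = 1`: ONE symmetric smooth `η ≥ 0` with an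
entire, NON-CONSTANT symbol `s = ĥ` acting on every `f_z^φ`, `φ ∈ V` — the input of ★ 12c's `hsep` through `exists_isOpen_forall_not_hasEigenvalue_of_eq_smul`. [cite: MoeglinWaldspurger1995, II.1.2] [cite: BernsteinLapid2019, §4 Claim 1] -/
theorem hnc_maximalLevel_cm_two
    (hVinf : ∀ φ ∈ chiSectionSpace χ (((standardMaximalCompactGL 2 L).comap (adelicVal (↥(maximalRealSubfield L)) L (IsCMField.complexConj L) 2 ((StdForm.antidiagonal 2).over L)) :
      Subgroup (quasiSplit (↥(maximalRealSubfield L)) L (IsCMField.complexConj L) 2).Adelic)) (fun _ => 1),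
      ∀ a : arch (↥(maximalRealSubfield L)) L (IsCMField.complexConj L) 2 ((StdForm.antidiagonal 2).over L), φ (archToAdelic (↥(maximalRealSubfield L)) L (IsCMField.complexConj L) 2 _ a) = φ 1) :
    ∃ η : GL (Fin 2) (AdeleRing (𝓞 L) L) → ℝ, IsTestFunctionGL 2 L η ∧ (∀ g, 0 ≤ η g) ∧ (∀ g, η g⁻¹ = η g) ∧
      ∃ s : ℂ → ℂ, Differentiable ℂ s ∧ (∃ z₁ z₂ : ℂ, s z₁ ≠ s z₂) ∧ ∀ z : ℂ, ∀ φ ∈ chiSectionSpace χ (((standardMaximalCompactGL 2 L).comap (adelicVal (↥(maximalRealSubfield L)) L (IsCMField.complexConj L) 2 ((StdForm.antidiagonal 2).over L)) :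
      Subgroup (quasiSplit (↥(maximalRealSubfield L)) L (IsCMField.complexConj L) 2).Adelic)) (fun _ => 1), ∀ x : (quasiSplit (↥(maximalRealSubfield L)) L (IsCMField.complexConj L) 2).Adelic,
        (∫ y, (fun y : (quasiSplit (↥(maximalRealSubfield L)) L (IsCMField.complexConj L) 2).Adelic =>
            orbitalSmoothing νG (fun x : (quasiSplit (↥(maximalRealSubfield L)) L (IsCMField.complexConj L) 2).Adelic => ((η (adelicVal (↥(maximalRealSubfield L)) L (IsCMField.complexConj L) 2 ((StdForm.antidiagonal 2).over L) x) : ℝ) : ℂ))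
              (fun x : (quasiSplit (↥(maximalRealSubfield L)) L (IsCMField.complexConj L) 2).Adelic => ((η (adelicVal (↥(maximalRealSubfield L)) L (IsCMField.complexConj L) 2 ((StdForm.antidiagonal 2).over L) x) : ℝ) : ℂ)) y) y *
          flatSectionU φ z (x * y) ∂νG) = s z * flatSectionU φ z x := by
  obtain ⟨η, h1, h2, h3, s, hs, -, hnc, hact⟩ := exists_testFunction_sphericalTransform_maximalLevel_cm_two L νG hVinf 0
  exact ⟨η, h1, h2, h3, s, hs, hnc, hact⟩

end Heads

end Summit.HodgeConjecture.HodgeConjecture.Cruxes.H413.K2E1ChiConvDataLettersMaximalLevelU2
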